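import Mathlib
import HarnessLib

/-!
# Discrete nonlocal-perimeter bound on the grid `ℤ³` (rung R9-core of line `LayerChain` v4, crux
# `StackingLiminf`, stmt-Ventures-19145): occupied–vacant pairs in a box are controlled by the
# directed edge boundary

Route `StickyWulffConstant` of the venture `Summits/Ventures/Crystal3D` (cell `crystal3d-full`).
Generic combinatorics, no Barlow geometry: for a finite `X ⊆ ℤ³` write
`f(Δ) = #{a ∈ X : a + Δ ∉ X}` (occupied sites whose `Δ`-translate is vacant) and let `M` bound the six
directed boundary counts `#{a ∈ X : a ± e_l ∉ X}`.
* `card_filter_add_add_notMem_le` — SUBADDITIVITY `f(Δ + u) ≤ f(Δ) + f(u)` (if `a + Δ + u` is vacant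
  then either `a + Δ` is vacant, or `b = a + Δ ∈ X` has `b + u` vacant; `a ↦ a + Δ` is injective);
* `card_filter_add_notMem_le` — hence `f(Δ) ≤ ‖Δ‖₁ · M` (induction on `‖Δ‖₁`, peeling unit steps);
* **`card_pairs_le`** — for any finite set `B` of displacements with `‖Δ‖₁ ≤ R` on `B`:
  `#{(a, Δ) ∈ X × B : a + Δ ∉ X} ≤ #B · R · M`.
For a box `B` of sides `≍ L, L, K` this is the pair count `≤ C L³ K · #∂X` of the planner's rung R9
(cf-p1 g13, `LayerChainV4Rungs.lean`), the combinatorial input of the bad-mass step of stub (C)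
`stub_plateauBound`; the transfer to Barlow stackings (index map `(k,i,j) ↦ barlowPos k i j`, whose
six grid moves are six of the twelve bonds for every Hägg word, so `#∂X ≤ 12N − 2·numContacts`) is a
separate file.  No paths are needed: the union bound is done one unit step at a time.
WHAT THIS IS NOT: nothing about stackings; rung F-C1 not moved.
-/

namespace Summit.Ventures.Crystal3D.Theorems.PlateauHeight

open Finset

/-- **Subadditivity of the vacant-translate count.**
`#{a ∈ X : a + (Δ + u) ∉ X} ≤ #{a ∈ X : a + Δ ∉ X} + #{b ∈ X : b + u ∉ X}`. -/
theorem card_filter_add_add_notMem_le (X : Finset (ℤ × ℤ × ℤ)) (Δ u : ℤ × ℤ × ℤ) :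
    (X.filter fun a => a + (Δ + u) ∉ X).card ≤
      (X.filter fun a => a + Δ ∉ X).card + (X.filter fun b => b + u ∉ X).card := by
  classical
  have hsub : (X.filter fun a => a + (Δ + u) ∉ X) ⊆
      (X.filter fun a => a + Δ ∉ X) ∪ (X.filter fun a => a + Δ ∈ X ∧ a + (Δ + u) ∉ X) := by
    intro a ha
    rw [mem_filter] at ha
    rw [mem_union, mem_filter, mem_filter]
    by_cases h : a + Δ ∈ X
    · exact Or.inr ⟨ha.1, h, ha.2⟩
    · exact Or.inl ⟨ha.1, h⟩
  have hinj : (X.filter fun a => a + Δ ∈ X ∧ a + (Δ + u) ∉ X).card ≤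
      (X.filter fun b => b + u ∉ X).card := by
    refine card_le_card_of_injOn (fun a => a + Δ) (fun a ha => ?_) fun a _ b _ hab => ?_
    · rw [mem_coe, mem_filter] at ha
      rw [mem_coe, mem_filter, add_assoc]
      exact ⟨ha.2.1, ha.2.2⟩
    · exact add_right_cancel hab
  exact (card_le_card hsub).trans ((card_union_le _ _).trans (by linarith))

/-- Peeling one unit step off a nonzero displacement of `ℤ³`. -/
theorem exists_unit_step (Δ : ℤ × ℤ × ℤ) (h : Δ ≠ 0) :
    ∃ u Δ' : ℤ × ℤ × ℤ, Δ = Δ' + u ∧ |u.1| + |u.2.1| + |u.2.2| = 1 ∧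
      |Δ'.1| + |Δ'.2.1| + |Δ'.2.2| + 1 = |Δ.1| + |Δ.2.1| + |Δ.2.2| := by
  obtain ⟨p, q, r⟩ := Δ
  simp only [ne_eq, Prod.mk_eq_zero, not_and] at h
  by_cases hp : p = 0
  · by_cases hq : q = 0
    · have hr : r ≠ 0 := h hp hq
      rcases lt_or_gt_of_ne hr with hr' | hr'
      · refine ⟨(0, 0, -1), (p, q, r + 1), by simp, by simp, ?_⟩
        simp only [hp, hq, abs_zero, zero_add]
        rw [abs_of_nonpos (by omega), abs_of_neg hr']; ring
      · refine ⟨(0, 0, 1), (p, q, r - 1), by simp, by simp, ?_⟩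
        simp only [hp, hq, abs_zero, zero_add]
        rw [abs_of_nonneg (by omega), abs_of_pos hr']; ring
    · rcases lt_or_gt_of_ne hq with hq' | hq'
      · refine ⟨(0, -1, 0), (p, q + 1, r), by simp, by simp, ?_⟩
        rw [abs_of_nonpos (by omega : q + 1 ≤ 0), abs_of_neg hq']; ring
      · refine ⟨(0, 1, 0), (p, q - 1, r), by simp, by simp, ?_⟩
        rw [abs_of_nonneg (by omega : 0 ≤ q - 1), abs_of_pos hq']; ring
  · rcases lt_or_gt_of_ne hp with hp' | hp'
    · refine ⟨(-1, 0, 0), (p + 1, q, r), by simp, by simp, ?_⟩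
      rw [abs_of_nonpos (by omega : p + 1 ≤ 0), abs_of_neg hp']; ring
    · refine ⟨(1, 0, 0), (p - 1, q, r), by simp, by simp, ?_⟩
      rw [abs_of_nonneg (by omega : 0 ≤ p - 1), abs_of_pos hp']; ring

/-- **Linear bound on the vacant-translate count.**  If every directed unit-step boundary count is
at most `M` then `#{a ∈ X : a + Δ ∉ X} ≤ ‖Δ‖₁ · M`. -/
theorem card_filter_add_notMem_le (X : Finset (ℤ × ℤ × ℤ)) (M : ℕ)
    (hM : ∀ u : ℤ × ℤ × ℤ, |u.1| + |u.2.1| + |u.2.2| = 1 → (X.filter fun a => a + u ∉ X).card ≤ M)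
    (Δ : ℤ × ℤ × ℤ) :
    (X.filter fun a => a + Δ ∉ X).card ≤ (|Δ.1| + |Δ.2.1| + |Δ.2.2|).toNat * M := by
  classical
  -- induction on `n = ‖Δ‖₁`
  suffices H : ∀ (n : ℕ) (Δ : ℤ × ℤ × ℤ), |Δ.1| + |Δ.2.1| + |Δ.2.2| = n →
      (X.filter fun a => a + Δ ∉ X).card ≤ n * M by
    have h0 : 0 ≤ |Δ.1| + |Δ.2.1| + |Δ.2.2| := by positivity
    have := H (|Δ.1| + |Δ.2.1| + |Δ.2.2|).toNat Δ (by rw [Int.toNat_of_nonneg h0])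
    exact this
  intro n
  induction n with
  | zero =>
    intro Δ hΔ
    simp only [Nat.cast_zero] at hΔ
    have h1 : Δ.1 = 0 := abs_eq_zero.1 (by linarith [abs_nonneg Δ.1, abs_nonneg Δ.2.1, abs_nonneg Δ.2.2])
    have h2 : Δ.2.1 = 0 := abs_eq_zero.1 (by linarith [abs_nonneg Δ.1, abs_nonneg Δ.2.1, abs_nonneg Δ.2.2])
    have h3 : Δ.2.2 = 0 := abs_eq_zero.1 (by linarith [abs_nonneg Δ.1, abs_nonneg Δ.2.1, abs_nonneg Δ.2.2])
    have hΔ0 : Δ = 0 := Prod.ext h1 (Prod.ext h2 h3)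
    subst hΔ0
    rw [zero_mul, Nat.le_zero, card_eq_zero, filter_eq_empty_iff]
    intro a ha
    rw [add_zero, not_not]
    exact ha
  | succ n ih =>
    intro Δ hΔ
    have hne : Δ ≠ 0 := by
      rintro rfl
      simp at hΔ
      omega
    obtain ⟨u, Δ', rfl, hu, hΔ'⟩ := exists_unit_step Δ hne
    have hn : |Δ'.1| + |Δ'.2.1| + |Δ'.2.2| = n := by
      have : (|Δ'.1| + |Δ'.2.1| + |Δ'.2.2| + 1 : ℤ) = (n : ℤ) + 1 := by rw [hΔ', hΔ]; push_cast; ring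
      linarith
    calc (X.filter fun a => a + (Δ' + u) ∉ X).card
        ≤ (X.filter fun a => a + Δ' ∉ X).card + (X.filter fun b => b + u ∉ X).card :=
          card_filter_add_add_notMem_le X Δ' u
      _ ≤ n * M + M := Nat.add_le_add (ih Δ' hn) (hM u hu)
      _ = (n + 1) * M := by ring

/-- **Occupied–vacant pairs in a displacement window.**  For finite `X ⊆ ℤ³`, any finite set `B` of
displacements with `‖Δ‖₁ ≤ R` on `B`, and `M` bounding the six directed boundary counts:
`#{(a, Δ) ∈ X × B : a + Δ ∉ X} ≤ #B · R · M`. -/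
theorem card_pairs_le (X B : Finset (ℤ × ℤ × ℤ)) (R M : ℕ)
    (hB : ∀ Δ ∈ B, (|Δ.1| + |Δ.2.1| + |Δ.2.2|).toNat ≤ R)
    (hM : ∀ u : ℤ × ℤ × ℤ, |u.1| + |u.2.1| + |u.2.2| = 1 → (X.filter fun a => a + u ∉ X).card ≤ M) :
    ((X ×ˢ B).filter fun q => q.1 + q.2 ∉ X).card ≤ B.card * R * M := by
  classical
  have hsplit : ((X ×ˢ B).filter fun q => q.1 + q.2 ∉ X).card =
      ∑ Δ ∈ B, (X.filter fun a => a + Δ ∉ X).card := by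
    rw [card_filter, sum_product_right]
    refine sum_congr rfl fun Δ _ => ?_
    rw [card_filter]
  rw [hsplit]
  calc ∑ Δ ∈ B, (X.filter fun a => a + Δ ∉ X).card
      ≤ ∑ Δ ∈ B, R * M := sum_le_sum fun Δ hΔ =>
        (card_filter_add_notMem_le X M hM Δ).trans (Nat.mul_le_mul_right _ (hB Δ hΔ))
    _ = B.card * R * M := by rw [sum_const, smul_eq_mul, mul_assoc]

end Summit.Ventures.Crystal3D.Theorems.PlateauHeight
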